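import Literature.AnabelianGeometry.AbsoluteAnabelian.HolomorphicEllipticCuspidalizationGenusOneHolds
import Literature.Geometry.Kaehler.ComplexTorusPuncturedDiscCovering
import HarnessLib

/-!
# The universal covering of a once-punctured elliptic curve is the disc ([AbsTopIII] §2 hypotheses at the genuine object)

Layer `Literature/AnabelianGeometry/AbsoluteAnabelian`, PROOF-ONLY (abc-iut cell, seat abc-iut-L4-t8, campaign-L
programme «UNIF-G1P», GAP G-L4t8g7-1).  S. Mochizuki, *Topics in Absolute Anabelian Geometry III*, §2:
Def. 2.1 (i) p. 50 («a hyperbolic Riemann surface of finite type», «an Aut-holomorphic disc»), Cor. 2.4 (a)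
p. 54 («Let `U^top → X^top` be any universal covering of `X^top`»), Cor. 2.4 (b)(c) pp. 54–55 and Cor. 2.7 (a)
p. 58 are typed in
`HolomorphicCores.lean` (`DeckGroupInAutIdComponent`, `HyperbolicCoreOrbispace`, both PROVED as typed) with
the universal covering `p : Ucov → X` — `Ucov` simply connected, `p` a surjective holomorphic covering
map, `IsAutHolDisc Ucov` — as HYPOTHESES.  For the curve IUT meets at every archimedean place, the
once-punctured elliptic curve `X_K = E ∖ {0}` ([IUTchI] Def. 3.1 (b); type `(1,1)`), this file PRODUCES
those hypotheses at the GENUINE object: for every punctured elliptic curve `E` in the typed (conformal)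
sense `TorsionPointsDenseUniqueGroupLaw.IsPuncturedEllipticCurve E` there is a holomorphic covering map
from the open unit disc onto `E` — CONDITIONAL on the one classical named fact
`Complex.PlaneDomainDiscCovering` (Koebe–Poincaré uniformization of plane domains, Fisher–Hubbard–Wittner
1988), and otherwise resting on theorems of the tree: genus-one uniformization
(`puncturedEllipticCurveModel_holds`, p434051), the disc covering of the punctured model torus
(`ComplexTorus.exists_disc_covering_compl_finite`), the covering-space library.

* `exists_disc_covering_of_isPuncturedEllipticCurve` — `∃ p : 𝔻 → E`, a surjective holomorphic covering;
* `exists_universalCover_isAutHolDisc_of_isPuncturedEllipticCurve` — the same packaged EXACTLY in the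
  binder shape of `DeckGroupInAutIdComponent` / `HyperbolicCoreOrbispace`: `(Ucov, p)` with
  `SimplyConnectedSpace Ucov`, `IsManifold 𝓘(ℂ, ℂ) ω Ucov`, `IsCoveringMap p`, `Surjective p`,
  `MDifferentiable p`, `IsAutHolDisc Ucov`.

HONEST FRAMING: classical uniformization for OUR typing of a refereed paper's hypotheses; conditional on a
named classical fact until «UNIF-G1P» N1 lands; nothing here bears on the disputed [IUTchIII] Cor. 3.12.

v2 (doc-only, referee note K27-n9): the header and the first theorem's docstring previously spliced «the
universal covering» into the Def. 2.1 (i) p. 50 quote; «universal covering» is Cor. 2.4 (a) p. 54 («Let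
`U^top → X^top` be any universal covering of `X^top`»), while «a hyperbolic Riemann surface of finite type» and
«an Aut-holomorphic disc» are Def. 2.1 (i) p. 50.  Quotes split and re-attributed; declarations unchanged.
-/

noncomputable section

open Set Function Metric TopologicalSpace
open scoped Manifold ContDiff Topology
open Literature.Geometry.Kaehler (ComplexTorus)

namespace Literature.AnabelianGeometry.AbsoluteAnabelian

namespace HolomorphicEllipticCuspidalization

variable (E : Type) [TopologicalSpace E] [T2Space E] [ChartedSpace ℂ E] [IsManifold 𝓘(ℂ, ℂ) ω E]

/-- **The disc covers every once-punctured elliptic curve, holomorphically** ([AbsTopIII] Def. 2.1 (i) p. 50: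
«a hyperbolic Riemann surface of finite type», «an Aut-holomorphic disc»; Cor. 2.4 (a) p. 54: «any universal
covering of `X^top`» — at the genuine curve of type `(1,1)`), conditional on
`Complex.PlaneDomainDiscCovering`: for `E` a punctured elliptic curve in the typed sense there is a
surjective holomorphic covering map `𝔻 → E` from the open unit disc (`unitDiscOpens`).  Route: `E ≅ ℂ/Φ(ℤ²) ∖ {0}` biholomorphically (genus-one uniformization,
`puncturedEllipticCurveModel_holds`), and the punctured model torus is covered by the disc
(`ComplexTorus.exists_disc_covering_compl_finite`). [cite: MochizukiAbsTopIII2015, Definition 2.1 (i) p.50] -/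
theorem exists_disc_covering_of_isPuncturedEllipticCurve (H : Complex.PlaneDomainDiscCovering)
    (hE : TorsionPointsDenseUniqueGroupLaw.IsPuncturedEllipticCurve E) :
    ∃ p : unitDiscOpens → E,
      IsCoveringMap p ∧ Function.Surjective p ∧ MDifferentiable 𝓘(ℂ, ℂ) 𝓘(ℂ, ℂ) p := by
  obtain ⟨Φ, e, -, he'⟩ := puncturedEllipticCurveModel_holds E hE
  obtain ⟨p, hp, hsurj, hpd⟩ :=
    ComplexTorus.exists_disc_covering_compl_finite Φ H (S := ({0} : Set (ComplexTorus Φ)))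
      (Set.finite_singleton 0) (Set.singleton_nonempty 0)
  exact ⟨e.symm ∘ p, hp.homeomorph_comp e.symm, e.symm.surjective.comp hsurj, he'.comp hpd⟩

/-- **The universal-covering hypotheses of [AbsTopIII] Cor. 2.4 (b)(c) / Cor. 2.7 (a) hold at the genuine
once-punctured elliptic curve**, conditional on `Complex.PlaneDomainDiscCovering`: for `E` a punctured
elliptic curve in the typed sense there are a simply connected Riemann surface `Ucov` which is an
Aut-holomorphic disc (`IsAutHolDisc`) and a surjective holomorphic covering map `p : Ucov → E` — the
binders `(Ucov, p)` of `DeckGroupInAutIdComponent` and `HyperbolicCoreOrbispace` (`HolomorphicCores.lean`).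
[cite: MochizukiAbsTopIII2015, Corollary 2.4 (b) p.54] -/
theorem exists_universalCover_isAutHolDisc_of_isPuncturedEllipticCurve
    (H : Complex.PlaneDomainDiscCovering)
    (hE : TorsionPointsDenseUniqueGroupLaw.IsPuncturedEllipticCurve E) :
    ∃ (Ucov : Type) (_ : TopologicalSpace Ucov) (_ : SimplyConnectedSpace Ucov) (_ : ChartedSpace ℂ Ucov)
      (_ : IsManifold 𝓘(ℂ, ℂ) ω Ucov) (p : Ucov → E),
      IsCoveringMap p ∧ Function.Surjective p ∧ MDifferentiable 𝓘(ℂ, ℂ) 𝓘(ℂ, ℂ) p ∧ IsAutHolDisc Ucov := by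
  obtain ⟨p, hp, hsurj, hpd⟩ := exists_disc_covering_of_isPuncturedEllipticCurve E H hE
  haveI : ContractibleSpace unitDiscOpens := by
    unfold unitDiscOpens
    exact (convex_ball (0 : ℂ) 1).contractibleSpace ⟨0, mem_ball_self one_pos⟩
  haveI : SimplyConnectedSpace unitDiscOpens := SimplyConnectedSpace.ofContractible _
  refine ⟨unitDiscOpens, inferInstance, inferInstance, inferInstance, inferInstance, p, hp, hsurj, hpd,
    ⟨⟨Homeomorph.refl _, ?_, ?_⟩⟩⟩
  · exact mdifferentiable_id
  · exact mdifferentiable_id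

end HolomorphicEllipticCuspidalization

end Literature.AnabelianGeometry.AbsoluteAnabelian

end
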